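import Literature.NumberTheory.Automorphic.ArchEndoscopicChartOrbUnfoldSplit      -- ★ p850514 (this seat): `exists_placeLeaf`, `exists_leafMeasure_archRH_mul_chartOrbH_eq`; brings ★ leaves p850437, ★ package p850180, ★ (T-MEAS), ★ scaling
import HarnessLib

/-!
# UNIFORM UNFOLDING, PER-PLACE EXPORT: the leaf measure is a PRODUCT over the places, `Λ = ⊗_w Λ_w`, with the compact-place leaves EXPLICIT
# (`Λ_w = (g ↦ (g,1))_* ν_w`, the whole-group orbital integral) — the Fubini-ready form of ★ `exists_leafMeasure_archRH_mul_chartOrbH_eq`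
# ((M1b′) of the LH3 direct road, export (α1); Harish-Chandra's `F_f^A` substitution at the split places)

Topic `NumberTheory/Automorphic`; namespace `Literature.NumberTheory.Automorphic.UnitaryGroup`.  THEOREMS ONLY (no `def`, no instance, no axiom, no `sorry`).
Cell `pub/hodgecm-mathlib`, crux H413 (`stmt-HodgeConjecture-24833`), line LH3 (closer stub `stub_N9`, DIRECT ROAD), organ O-L3′ conjunct (ii) pay-down for GENERAL `fH`
(LH3-plan (g3) RULINGS #7 (d) ∕ #11; stage (α1) of the transport of the one-place all-orders engine ★ `ArchRankOneCasimirLadder`∕`…AllOrders` (LH3-p04 (g4)) to `h2`).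
Author LH3-p01 (g4).  Count-neutral.

WHY.  ★ `exists_leafMeasure_archRH_mul_chartOrbH_eq_of_isHaarMeasure` packages the leaf measure as ONE measure `Λ` on `A × A` with a properness clause — enough for [C1b]
(★ `contDiffOn_stOrbFamH_slab_zero`), where only smoothness INSIDE `InRegS S` is at stake.  The (I₂) bound `h2` (bounded jets up to the compact faces) needs to integrate ONE
compact place `w₀` out FIRST and to see the `w₀`-leaf as the whole-group orbital integral of `U(Φ₂)_{w₀}` (the functional of the one-place engine), the other leaves being
parameters.  This file therefore exports the PRODUCT STRUCTURE: measures `Λ_w` on `G_w × G_w` (`G_w = U(Φ₂)_w`), closed leaves `Z_w` carrying them, per-place properness,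
the EXPLICIT compact-place leaves `Λ_w = (g ↦ (g, 1))_* ν_w` (`w ∉ S`), and the identity BEFORE folding,
  `archRH S c · chartOrbH L νH S fH c = K₀ · E_S(c) · ∫ fH(eA⁻¹ (z_{w,1} · (γ_w(c) · z_{w,2}) · z_{w,1}⁻¹)_w, (endoTorus S c).2) d(⊗_w Λ_w)(z)`  (`c ∈ RegS S`),
so that a consumer splits `⊗_w Λ_w = Λ_{w₀} ⊗ (⊗_{w ≠ w₀} Λ_w)` by Mathlib's `measurePreserving_piEquivPiSubtypeProd` ∕ `measurePreserving_piUnique`.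
* `exists_placeLeaf_explicit` — ★ `exists_placeLeaf` with the compact-place leaf named (`w ∉ S → Λ_w = (g ↦ (g,1))_* ν_w`).
* **`exists_placeLeaves_archRH_mul_chartOrbH_eq`** (product Haar convention) and **`…_of_isHaarMeasure`** (arbitrary Haar `νH`, the places' Haar measures `ν_w` exported).
HONEST LABEL: HC_CM is proved only modulo the 7 printed citations (2 remaining: hLiu418 = stmt-HodgeConjecture-24832, h413 = stmt-HodgeConjecture-24833) until rung 0
closes; measure-theoretic bookkeeping over ★ p850514, pays nothing by itself.

## References
* [Varadarajan1989] V. S. Varadarajan, *An Introduction to Harmonic Analysis on Semisimple Lie Groups* (1989), §6.4 Lemma 21, Thm 23.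
* [Shelstad1979] D. Shelstad, *Characters and inner forms of a quasi-split group over ℝ*, Compositio Math. 39 (1979), §4 pp. 22–25.
* [Folland1995] G. B. Folland, *A Course in Abstract Harmonic Analysis* (1995), §2.6 Thm. 2.49, (2.52).
* [BorelJacquet1979] A. Borel, H. Jacquet, *Automorphic forms and automorphic representations*, PSPM 33.1 (1979), §4.1.
-/

set_option autoImplicit false

noncomputable section

open MeasureTheory MeasureTheory.Measure NumberField NumberField.InfinitePlace Matrix Complex Topology Set
open Literature.MeasureTheory.Group Literature.NumberTheory.Automorphic.ArchCartan
open scoped MatrixGroups Matrix ENNReal NNReal ComplexConjugate Classical Pointwise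

namespace Literature.NumberTheory.Automorphic.UnitaryGroup

local notation3 "Φ₂[" L "]" => (Matrix.of fun i j : Fin 2 => if i.val + j.val + 1 = 2 then (1 : L) else 0)
local notation3 "Φ₁[" L "]" => (Matrix.of fun i j : Fin 1 => if i.val + j.val + 1 = 1 then (1 : L) else 0)
local notation3 "𝔸[" L "]" => ↥(arch (↥(maximalRealSubfield L)) L (IsCMField.complexConj L) 2 Φ₂[L])
local notation3 "𝔹[" L "]" => ↥(arch (↥(maximalRealSubfield L)) L (IsCMField.complexConj L) 1 Φ₁[L])

/-! ## §1 The per-place leaf with the compact-place leaf explicit -/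

section PlaceLeaf

variable (L : Type) [Field L] [NumberField L] [IsCMField L] (S : Finset {w : InfinitePlace L // IsComplex w}) (w : {w : InfinitePlace L // IsComplex w})
  [MeasurableSpace ↥(archLocal L 2 Φ₂[L] w)] [BorelSpace ↥(archLocal L 2 Φ₂[L] w)]
  [LocallyCompactSpace ↥(archLocal L 2 Φ₂[L] w)] [SecondCountableTopology ↥(archLocal L 2 Φ₂[L] w)]
  (νw : Measure ↥(archLocal L 2 Φ₂[L] w)) [νw.IsHaarMeasure] [νw.IsMulRightInvariant]

/-- **THE PER-PLACE LEAF PACKAGE, COMPACT LEAF EXPLICIT**: as ★ `exists_placeLeaf` (finite on compacta, closed leaf carrying it, `C_w ≠ 0`, properness, the orbital-measure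
identity), with the extra clause `w ∉ S → Λ_w = (g ↦ (g, 1))_* ν_w` — at a compact place the leaf integral IS the whole-group orbital integral `∫_{U(Φ₂)_w} f(g γ g⁻¹) dν_w(g)`.
[cite: Folland1995, §2.6 (2.52)] [cite: Rogawski1990, §8.2 pp. 119–122] [cite: Varadarajan1989, §6.4 Lemma 21] -/
theorem exists_placeLeaf_explicit
    [MeasurableSpace (↥(archLocal L 2 Φ₂[L] w) ⧸ chartTorusHLoc L S w)] [BorelSpace (↥(archLocal L 2 Φ₂[L] w) ⧸ chartTorusHLoc L S w)]
    [(chartHaarHLoc L S w).IsHaarMeasure] [(chartHaarHLoc L S w).IsInvInvariant] :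
    ∃ (Λw : Measure (↥(archLocal L 2 Φ₂[L] w) × ↥(archLocal L 2 Φ₂[L] w))) (Zw : Set (↥(archLocal L 2 Φ₂[L] w) × ↥(archLocal L 2 Φ₂[L] w))) (Cw : ℝ≥0),
      IsFiniteMeasureOnCompacts Λw ∧ IsClosed Zw ∧ Λw Zwᶜ = 0 ∧ Cw ≠ 0 ∧
      (∀ U : Set ({w : InfinitePlace L // IsComplex w} → Fin 3 → ℝ), IsCompact U → (w ∉ S → ∀ c ∈ U, Circle.exp (c w 0) ≠ Circle.exp (c w 2)) →
        ∀ C' : Set ↥(archLocal L 2 Φ₂[L] w), IsCompact C' →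
          ∃ 𝒮 : Set (↥(archLocal L 2 Φ₂[L] w) × ↥(archLocal L 2 Φ₂[L] w)), IsCompact 𝒮 ∧
            ∀ z ∈ Zw, ∀ c ∈ U, z.1 * (endoBlockAt L S w (c w) * z.2) * z.1⁻¹ ∈ C' → z ∈ 𝒮) ∧
      (w ∉ S → Λw = Measure.map (fun g : ↥(archLocal L 2 Φ₂[L] w) => (g, (1 : ↥(archLocal L 2 Φ₂[L] w)))) νw) ∧
      ∀ c : {w : InfinitePlace L // IsComplex w} → Fin 3 → ℝ, (w ∈ S → c w 0 ≠ 0) →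
        Measure.map (descConj (endoBlockAt L S w (c w)) (chartTorusHLoc L S w) (forall_mem_chartTorusHLoc_comm L S w (c w)) id)
            (quotientMeasure (chartTorusHLoc L S w) (chartHaarHLoc L S w) (isClosed_chartTorusHLoc L S w) νw) =
          (Cw * (if w ∈ S then ‖(((Real.exp (-2 * c w 0) : ℝ) : ℂ)) - 1‖₊⁻¹ else 1)) •
            Measure.map (fun z : ↥(archLocal L 2 Φ₂[L] w) × ↥(archLocal L 2 Φ₂[L] w) => z.1 * (endoBlockAt L S w (c w) * z.2) * z.1⁻¹) Λw := by
  by_cases hw : w ∈ S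
  · -- SPLIT place: ★ `exists_placeLeaf`, the extra clause is vacuous
    obtain ⟨Λw, Zw, Cw, hΛc, hZc, hnull, hC, hprop, hleaf⟩ := exists_placeLeaf L S w νw
    exact ⟨Λw, Zw, Cw, hΛc, hZc, hnull, hC, hprop, fun h => absurd hw h, hleaf⟩
  · -- COMPACT place: the leaf `G_w × {1}` (as in ★ `exists_placeLeaf`, with the leaf named)
    haveI := sigmaFinite_chartHaarHLoc L S w
    haveI := locallyCompactSpace_chartTorusHLoc L S w
    haveI : CompactSpace ↥(chartTorusHLoc L S w) := compactSpace_chartTorusHLoc_of_not_mem L S w hw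
    have hne : chartHaarHLoc L S w Set.univ ≠ 0 := (isOpen_univ.measure_pos (chartHaarHLoc L S w) univ_nonempty).ne'
    have hlt : chartHaarHLoc L S w Set.univ ≠ ⊤ := (isCompact_univ.measure_lt_top (μ := chartHaarHLoc L S w)).ne
    have hι : IsClosedEmbedding (fun g : ↥(archLocal L 2 Φ₂[L] w) => (g, (1 : ↥(archLocal L 2 Φ₂[L] w)))) := by
      refine ⟨isEmbedding_graph continuous_const, ?_⟩
      have hr : Set.range (fun g : ↥(archLocal L 2 Φ₂[L] w) => (g, (1 : ↥(archLocal L 2 Φ₂[L] w)))) = Set.univ ×ˢ {1} := by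
        ext z
        simp only [Set.mem_range, Set.mem_prod, Set.mem_univ, Set.mem_singleton_iff, true_and]
        constructor
        · rintro ⟨g, rfl⟩; rfl
        · intro h; exact ⟨z.1, Prod.ext rfl h.symm⟩
      rw [hr]
      exact isClosed_univ.prod isClosed_singleton
    refine ⟨Measure.map (fun g : ↥(archLocal L 2 Φ₂[L] w) => (g, (1 : ↥(archLocal L 2 Φ₂[L] w)))) νw, Set.univ ×ˢ {1},
      (chartHaarHLoc L S w Set.univ).toNNReal⁻¹, ?_, isClosed_univ.prod isClosed_singleton, ?_,
      inv_ne_zero (ENNReal.toNNReal_ne_zero.2 ⟨hne, hlt⟩), fun U hU hreg C' hC' => ?_, fun _ => rfl, fun c _ => ?_⟩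
    · refine ⟨fun C' hC' => ?_⟩
      rw [hι.measurableEmbedding.map_apply]
      exact (hι.isCompact_preimage hC').measure_lt_top
    · rw [hι.measurableEmbedding.map_apply]
      have hempty : (fun g : ↥(archLocal L 2 Φ₂[L] w) => (g, (1 : ↥(archLocal L 2 Φ₂[L] w)))) ⁻¹' (Set.univ ×ˢ {1})ᶜ = ∅ := by
        ext g
        simp only [Set.mem_preimage, Set.mem_compl_iff, Set.mem_prod, Set.mem_univ, Set.mem_singleton_iff, and_self, not_true_eq_false,
          Set.mem_empty_iff_false]
      rw [hempty, measure_empty]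
    · refine ⟨{y : ↥(archLocal L 2 Φ₂[L] w) | ∃ c ∈ U, y * endoBlock L S c w * y⁻¹ ∈ C'} ×ˢ {1},
        (isCompact_setOf_exists_conj_endoBlock_mem_of_not_mem L w S hw hU (hreg hw) hC').prod isCompact_singleton, ?_⟩
      rintro z ⟨-, hz2⟩ c hcU hmem
      rw [Set.mem_singleton_iff] at hz2
      refine ⟨⟨c, hcU, ?_⟩, hz2⟩
      rw [hz2, mul_one] at hmem
      exact hmem
    · rw [if_neg hw, mul_one]
      exact map_descConj_quotientMeasure_eq_smul_map_pair_one (chartTorusHLoc L S w) (isClosed_chartTorusHLoc L S w) (chartHaarHLoc L S w) νw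
        (endoBlockAt L S w (c w)) (forall_mem_chartTorusHLoc_comm L S w (c w))

end PlaceLeaf

/-! ## §2 The assembly over all places, NOT folded: the identity against `⊗_w Λ_w` -/

section Generic

/-- A measure carried by a closed leaf on which a continuous map is proper is pushed forward to a measure finite on compacta (local copy of the private helper of ★
`ArchEndoscopicChartOrbUnfoldSplit`). [folklore] -/
private theorem isFiniteMeasureOnCompacts_map_of_leaf' {X Y : Type*} [TopologicalSpace X] [MeasurableSpace X] [BorelSpace X] [TopologicalSpace Y] [T2Space Y]
    [MeasurableSpace Y] [BorelSpace Y] (μ : Measure X) [IsFiniteMeasureOnCompacts μ] {Z : Set X} (hZ : μ Zᶜ = 0) {m : X → Y} (hm : Continuous m)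
    (hprop : ∀ C : Set Y, IsCompact C → ∃ 𝒮 : Set X, IsCompact 𝒮 ∧ ∀ z ∈ Z, m z ∈ C → z ∈ 𝒮) : IsFiniteMeasureOnCompacts (μ.map m) := by
  refine ⟨fun C hC => ?_⟩
  obtain ⟨𝒮, h𝒮, h⟩ := hprop C hC
  rw [Measure.map_apply hm.measurable hC.measurableSet]
  have hsub : m ⁻¹' C ⊆ 𝒮 ∪ Zᶜ := fun z hz => by
    by_cases hzZ : z ∈ Z
    · exact Or.inl (h z hzZ hz)
    · exact Or.inr hzZ
  calc μ (m ⁻¹' C) ≤ μ (𝒮 ∪ Zᶜ) := measure_mono hsub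
    _ ≤ μ 𝒮 + μ Zᶜ := measure_union_le _ _
    _ < ⊤ := by rw [hZ, add_zero]; exact h𝒮.measure_lt_top

end Generic

section Assembly

variable (L : Type) [Field L] [NumberField L] [IsCMField L] (S : Finset {w : InfinitePlace L // IsComplex w})
  [∀ w : {w : InfinitePlace L // IsComplex w}, MeasurableSpace ↥(archLocal L 2 Φ₂[L] w)]
  [∀ w : {w : InfinitePlace L // IsComplex w}, BorelSpace ↥(archLocal L 2 Φ₂[L] w)]
  [MeasurableSpace 𝔸[L]] [BorelSpace 𝔸[L]] [MeasurableSpace 𝔹[L]] [BorelSpace 𝔹[L]]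
  (νw : ∀ w : {w : InfinitePlace L // IsComplex w}, Measure ↥(archLocal L 2 Φ₂[L] w)) [∀ w, (νw w).IsHaarMeasure] [∀ w, (νw w).IsMulRightInvariant]
  (νB : Measure 𝔹[L]) [νB.IsHaarMeasure] [νB.IsMulRightInvariant]
  (νH : Measure (𝔸[L] × 𝔹[L])) [νH.IsHaarMeasure] [νH.IsMulRightInvariant]
  (hν : νH = ((Measure.pi νw).map (archPiEquivCM 2 L Φ₂[L]).symm).prod νB)

set_option maxHeartbeats 400000 in
include hν in
/-- **UNIFORM UNFOLDING, PER-PLACE FORM (product Haar convention).**  For `νH = (eA⁻¹_* ⊗_w ν_w) ⊗ ν_B`, every label `S` and every continuous `fH` there are `K₀ : ℝ`, measures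
`Λ_w` on `G_w × G_w` finite on compacta and CLOSED leaves `Z_w` carrying them (independent of `c`), with per-place PROPERNESS, the compact-place leaves EXPLICIT
(`w ∉ S → Λ_w = (g ↦ (g,1))_* ν_w`), and for every `c ∈ RegS S`
`archRH S c · chartOrbH L νH S fH c = K₀ · (Π_w [w ∈ S ? e^{c_w0} : 1 − e^{i(c_w2 − c_w0)}]) · ∫ fH(eA⁻¹ (z_{w,1} · (endoBlockAt S w (c w) · z_{w,2}) · z_{w,1}⁻¹)_w, (endoTorus L S c).2) d(⊗_w Λ_w)(z)`.
[cite: Varadarajan1989, §6.4 Lemma 21, Thm 23] [cite: Shelstad1979, §4 pp. 22–25] [cite: Folland1995, §2.6 (2.52)] [cite: BorelJacquet1979, §4.1] -/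
theorem exists_placeLeaves_archRH_mul_chartOrbH_eq (fH : 𝔸[L] × 𝔹[L] → ℂ) (hfH : Continuous fH) :
    ∃ (K₀ : ℝ) (Λw : ∀ w : {w : InfinitePlace L // IsComplex w}, Measure (↥(archLocal L 2 Φ₂[L] w) × ↥(archLocal L 2 Φ₂[L] w)))
      (Zw : ∀ w : {w : InfinitePlace L // IsComplex w}, Set (↥(archLocal L 2 Φ₂[L] w) × ↥(archLocal L 2 Φ₂[L] w))),
      (∀ w, IsFiniteMeasureOnCompacts (Λw w)) ∧ (∀ w, IsClosed (Zw w)) ∧ (∀ w, Λw w (Zw w)ᶜ = 0) ∧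
      (∀ w, w ∉ S → Λw w = Measure.map (fun g : ↥(archLocal L 2 Φ₂[L] w) => (g, (1 : ↥(archLocal L 2 Φ₂[L] w)))) (νw w)) ∧
      (∀ (w) (U : Set ({w : InfinitePlace L // IsComplex w} → Fin 3 → ℝ)), IsCompact U → (w ∉ S → ∀ c ∈ U, Circle.exp (c w 0) ≠ Circle.exp (c w 2)) →
        ∀ C' : Set ↥(archLocal L 2 Φ₂[L] w), IsCompact C' →
          ∃ 𝒮 : Set (↥(archLocal L 2 Φ₂[L] w) × ↥(archLocal L 2 Φ₂[L] w)), IsCompact 𝒮 ∧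
            ∀ z ∈ Zw w, ∀ c ∈ U, z.1 * (endoBlockAt L S w (c w) * z.2) * z.1⁻¹ ∈ C' → z ∈ 𝒮) ∧
      ∀ c : {w : InfinitePlace L // IsComplex w} → Fin 3 → ℝ, c ∈ RegS S →
        archRH S c * chartOrbH L νH S fH c =
          (K₀ : ℂ) * (∏ w, (if w ∈ S then ((Real.exp (c w 0) : ℝ) : ℂ) else 1 - (Circle.exp (c w 2 - c w 0) : ℂ))) *
            ∫ z, fH ((archPiEquivCM 2 L Φ₂[L]).symm (fun w => (z w).1 * (endoBlockAt L S w (c w) * (z w).2) * (z w).1⁻¹), (endoTorus L S c).2)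
              ∂(Measure.pi Λw) := by
  -- instances at the places, on the quotients, on the chart tori
  haveI : ∀ w : {w : InfinitePlace L // IsComplex w}, LocallyCompactSpace ↥(archLocal L 2 Φ₂[L] w) := fun w => locallyCompactSpace_archLocal_two L w
  haveI : ∀ w : {w : InfinitePlace L // IsComplex w}, SecondCountableTopology ↥(archLocal L 2 Φ₂[L] w) := fun w => secondCountableTopology_archLocal_two L w
  letI : ∀ w : {w : InfinitePlace L // IsComplex w}, MeasurableSpace (↥(archLocal L 2 Φ₂[L] w) ⧸ chartTorusHLoc L S w) := fun w => borel _
  haveI : ∀ w : {w : InfinitePlace L // IsComplex w}, BorelSpace (↥(archLocal L 2 Φ₂[L] w) ⧸ chartTorusHLoc L S w) := fun w => ⟨rfl⟩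
  letI : MeasurableSpace ((𝔸[L] × 𝔹[L]) ⧸ chartTorusH L S) := borel _
  haveI : BorelSpace ((𝔸[L] × 𝔹[L]) ⧸ chartTorusH L S) := ⟨rfl⟩
  haveI : ∀ w, (chartHaarHLoc L S w).IsHaarMeasure := fun w => isHaarMeasure_chartHaarHLoc L S w
  haveI : ∀ w, (chartHaarHLoc L S w).IsInvInvariant := fun w => isInvInvariant_chartHaarHLoc L S w
  haveI : ∀ w, SigmaFinite (chartHaarHLoc L S w) := fun w => sigmaFinite_chartHaarHLoc L S w
  haveI : νB.IsInvInvariant := isInvInvariant_of_isHaarMeasure_archOne L νB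
  haveI := locallyCompactSpace_chartTorusH L S
  -- the product-quotient package
  obtain ⟨ρ, hρH, hρI, -, hcov, -⟩ := exists_haar_quotientMeasure_prod_pi_top (archPiEquivCM 2 L Φ₂[L])
    (fun w => chartTorusHLoc L S w) (fun w => isClosed_chartTorusHLoc L S w) (chartTorusH L S) (isClosed_chartTorusH L S)
    (mem_chartTorusH_iff_forall_mem_chartTorusHLoc L S) (fun w => chartHaarHLoc L S w) νw νB νH hν
  -- the per-place leaves (compact leaves explicit)
  choose Λw Zw Cw hΛfin hZcl hZnull hCne hprop hexpl hleaf using fun w : {w : InfinitePlace L // IsComplex w} => exists_placeLeaf_explicit L S w (νw w)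
  haveI : ∀ w, IsFiniteMeasureOnCompacts (Λw w) := hΛfin
  refine ⟨(ρ (chartBoxImg L S)).toReal * ∏ w, (Cw w : ℝ), Λw, Zw, hΛfin, hZcl, hZnull, hexpl, hprop, fun c hc => ?_⟩
  have hc1 : ∀ w, w ∈ S → c w 0 ≠ 0 := ((mem_regS_iff S c).1 hc).2
  -- (1) Haar-freeness + the package
  have hint : ∫ y, descConj (endoTorus L S c) (chartTorusH L S) (forall_mem_chartTorusH_comm L S c) fH y
      ∂(quotientMeasure (chartTorusH L S) ρ (isClosed_chartTorusH L S) νH) =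
      ∫ p, fH ((archPiEquivCM 2 L Φ₂[L]).symm (fun w => descConj (endoBlockAt L S w (c w)) (chartTorusHLoc L S w)
        (forall_mem_chartTorusHLoc_comm L S w (c w)) id (p w)), (endoTorus L S c).2)
        ∂(Measure.pi fun w => quotientMeasure (chartTorusHLoc L S w) (chartHaarHLoc L S w) (isClosed_chartTorusHLoc L S w) (νw w)) :=
    hcov (fun w => endoBlockAt L S w (c w)) (endoTorus L S c).2 (fun w => forall_mem_chartTorusHLoc_comm L S w (c w))
      (forall_mem_chartTorusH_comm L S c) fH
  -- (2) the orbital measures of the places and their leaves (`m w` the leaf parametrisation, `Φ` the integrand on `Π_w G_w`, `dsc` the scalars)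
  let m : ∀ w : {w : InfinitePlace L // IsComplex w}, ↥(archLocal L 2 Φ₂[L] w) × ↥(archLocal L 2 Φ₂[L] w) → ↥(archLocal L 2 Φ₂[L] w) :=
    fun w z => z.1 * (endoBlockAt L S w (c w) * z.2) * z.1⁻¹
  have hm_c : ∀ w, Continuous (m w) := fun w => (continuous_fst.mul (continuous_const.mul continuous_snd)).mul continuous_fst.inv
  let Φ : (∀ w : {w : InfinitePlace L // IsComplex w}, ↥(archLocal L 2 Φ₂[L] w)) → ℂ :=
    fun g => fH ((archPiEquivCM 2 L Φ₂[L]).symm g, (endoTorus L S c).2)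
  have hΦ_c : Continuous Φ := hfH.comp (((archPiEquivCM 2 L Φ₂[L]).symm.continuous).prodMk continuous_const)
  let dsc : {w : InfinitePlace L // IsComplex w} → ℝ≥0 := fun w => Cw w * (if w ∈ S then ‖(((Real.exp (-2 * c w 0) : ℝ) : ℂ)) - 1‖₊⁻¹ else 1)
  have hD_c : Continuous (fun (p : ∀ w : {w : InfinitePlace L // IsComplex w}, ↥(archLocal L 2 Φ₂[L] w) ⧸ chartTorusHLoc L S w)
      (w : {w : InfinitePlace L // IsComplex w}) =>
      descConj (endoBlockAt L S w (c w)) (chartTorusHLoc L S w) (forall_mem_chartTorusHLoc_comm L S w (c w)) id (p w)) :=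
    continuous_pi fun w => (continuous_descConj (endoBlockAt L S w (c w)) (chartTorusHLoc L S w) _ continuous_id).comp (continuous_apply w)
  have hM_c : Continuous (fun (z : ∀ w : {w : InfinitePlace L // IsComplex w}, ↥(archLocal L 2 Φ₂[L] w) × ↥(archLocal L 2 Φ₂[L] w))
      (w : {w : InfinitePlace L // IsComplex w}) => m w (z w)) :=
    continuous_pi fun w => (hm_c w).comp (continuous_apply w)
  have hO : ∀ w, (quotientMeasure (chartTorusHLoc L S w) (chartHaarHLoc L S w) (isClosed_chartTorusHLoc L S w) (νw w)).map
      (descConj (endoBlockAt L S w (c w)) (chartTorusHLoc L S w) (forall_mem_chartTorusHLoc_comm L S w (c w)) id) = dsc w • (Λw w).map (m w) :=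
    fun w => hleaf w c (hc1 w)
  -- the leaf images are finite on compacta (properness at the single point `c`), hence σ-finite
  have hmfin : ∀ w, IsFiniteMeasureOnCompacts ((Λw w).map (m w)) := by
    intro w
    refine isFiniteMeasureOnCompacts_map_of_leaf' (Λw w) (hZnull w) (hm_c w) fun C' hC' => ?_
    obtain ⟨𝒮, h𝒮, h⟩ := hprop w {c} isCompact_singleton (fun hw c' hc' => by
      rw [Set.mem_singleton_iff.1 hc']; exact ((mem_regS_iff S c).1 hc).1 w hw) C' hC'
    exact ⟨𝒮, h𝒮, fun z hz hzC => h z hz c (Set.mem_singleton c) hzC⟩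
  haveI : ∀ w, SigmaFinite ((Λw w).map (m w)) := fun w => by haveI := hmfin w; infer_instance
  haveI : ∀ w, SigmaFinite ((quotientMeasure (chartTorusHLoc L S w) (chartHaarHLoc L S w) (isClosed_chartTorusHLoc L S w) (νw w)).map
      (descConj (endoBlockAt L S w (c w)) (chartTorusHLoc L S w) (forall_mem_chartTorusHLoc_comm L S w (c w)) id)) := fun w => by
    rw [hO w]; haveI := hmfin w; infer_instance
  -- (3) assemble: package → image of the product of quotient measures → product of leaves → fold
  have hstep : ∫ p, fH ((archPiEquivCM 2 L Φ₂[L]).symm (fun w => descConj (endoBlockAt L S w (c w)) (chartTorusHLoc L S w)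
        (forall_mem_chartTorusHLoc_comm L S w (c w)) id (p w)), (endoTorus L S c).2)
        ∂(Measure.pi fun w => quotientMeasure (chartTorusHLoc L S w) (chartHaarHLoc L S w) (isClosed_chartTorusHLoc L S w) (νw w)) =
      (∏ w, dsc w) • ∫ z, fH ((archPiEquivCM 2 L Φ₂[L]).symm (fun w => (z w).1 * (endoBlockAt L S w (c w) * (z w).2) * (z w).1⁻¹), (endoTorus L S c).2)
        ∂(Measure.pi Λw) := by
    -- as an integral of `Φ` against the image measure, then `pi_map_pi`, the leaves, `pi_nnreal_smul_map`, and the fold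
    have h1 : (fun p : (∀ w : {w : InfinitePlace L // IsComplex w}, ↥(archLocal L 2 Φ₂[L] w) ⧸ chartTorusHLoc L S w) =>
        fH ((archPiEquivCM 2 L Φ₂[L]).symm (fun w => descConj (endoBlockAt L S w (c w)) (chartTorusHLoc L S w)
          (forall_mem_chartTorusHLoc_comm L S w (c w)) id (p w)), (endoTorus L S c).2)) =
        fun p => Φ (fun w => descConj (endoBlockAt L S w (c w)) (chartTorusHLoc L S w) (forall_mem_chartTorusHLoc_comm L S w (c w)) id (p w)) := rfl
    rw [h1, ← integral_map hD_c.measurable.aemeasurable hΦ_c.aestronglyMeasurable,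
      Measure.pi_map_pi (fun w => (continuous_descConj (endoBlockAt L S w (c w)) (chartTorusHLoc L S w) _ continuous_id).measurable.aemeasurable)]
    have h2 : (Measure.pi fun w => (quotientMeasure (chartTorusHLoc L S w) (chartHaarHLoc L S w) (isClosed_chartTorusHLoc L S w) (νw w)).map
        (descConj (endoBlockAt L S w (c w)) (chartTorusHLoc L S w) (forall_mem_chartTorusHLoc_comm L S w (c w)) id)) =
        Measure.pi fun w => dsc w • (Λw w).map (m w) := congrArg Measure.pi (funext hO)
    rw [h2, pi_nnreal_smul_map Λw m (fun w => (hm_c w).measurable) dsc, integral_smul_nnreal_measure,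
      integral_map hM_c.measurable.aemeasurable hΦ_c.aestronglyMeasurable]
  -- (4) scalars
  rw [chartOrbH_eq_of_isHaarMeasure L S νH ρ fH c]
  show archRH S c * (((ρ (chartBoxImg L S)).toReal : ℂ) * ∫ y, descConj (endoTorus L S c) (chartTorusH L S) (forall_mem_chartTorusH_comm L S c) fH y
      ∂(quotientMeasure (chartTorusH L S) ρ (isClosed_chartTorusH L S) νH)) = _
  rw [hint, hstep]
  have hfac : ∀ w, (if w ∈ S then ((|Real.exp (c w 0) - Real.exp (-c w 0)| : ℝ) : ℂ) else 1 - (Circle.exp (c w 2 - c w 0) : ℂ)) * ((dsc w : ℝ) : ℂ) =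
      ((Cw w : ℝ) : ℂ) * (if w ∈ S then ((Real.exp (c w 0) : ℝ) : ℂ) else 1 - (Circle.exp (c w 2 - c w 0) : ℂ)) := by
    intro w
    by_cases hw : w ∈ S
    · simp only [dsc, if_pos hw, NNReal.coe_mul, NNReal.coe_inv, coe_nnnorm, Complex.ofReal_mul, Complex.ofReal_inv]
      have h := abs_exp_sub_exp_neg_mul_norm_inv (c w 0) (hc1 w hw)
      calc ((|Real.exp (c w 0) - Real.exp (-c w 0)| : ℝ) : ℂ) * (((Cw w : ℝ) : ℂ) * (((‖(((Real.exp (-2 * c w 0) : ℝ) : ℂ)) - 1‖ : ℝ) : ℂ))⁻¹)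
          = ((Cw w : ℝ) : ℂ) * (((|Real.exp (c w 0) - Real.exp (-c w 0)| * ‖(((Real.exp (-2 * c w 0) : ℝ) : ℂ)) - 1‖⁻¹ : ℝ)) : ℂ) := by
            push_cast; ring
        _ = ((Cw w : ℝ) : ℂ) * ((Real.exp (c w 0) : ℝ) : ℂ) := by rw [h]
    · simp only [dsc, if_neg hw, mul_one]
      ring
  have harch : archRH S c = ∏ w, (if w ∈ S then ((|Real.exp (c w 0) - Real.exp (-c w 0)| : ℝ) : ℂ) else 1 - (Circle.exp (c w 2 - c w 0) : ℂ)) := by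
    unfold archRH
    exact Finset.prod_congr rfl fun w _ => by congr 1
  rw [NNReal.smul_def, Complex.real_smul, NNReal.coe_prod, Complex.ofReal_prod, harch, Complex.ofReal_mul, Complex.ofReal_prod]
  have hprod : (∏ w, (if w ∈ S then ((|Real.exp (c w 0) - Real.exp (-c w 0)| : ℝ) : ℂ) else 1 - (Circle.exp (c w 2 - c w 0) : ℂ))) * ∏ w, ((dsc w : ℝ) : ℂ) =
      (∏ w, ((Cw w : ℝ) : ℂ)) * ∏ w, (if w ∈ S then ((Real.exp (c w 0) : ℝ) : ℂ) else 1 - (Circle.exp (c w 2 - c w 0) : ℂ)) := by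
    rw [← Finset.prod_mul_distrib, ← Finset.prod_mul_distrib]
    exact Finset.prod_congr rfl fun w _ => hfac w
  calc (∏ w, (if w ∈ S then ((|Real.exp (c w 0) - Real.exp (-c w 0)| : ℝ) : ℂ) else 1 - (Circle.exp (c w 2 - c w 0) : ℂ))) *
        (((ρ (chartBoxImg L S)).toReal : ℂ) * ((∏ w, ((dsc w : ℝ) : ℂ)) *
          ∫ z, fH ((archPiEquivCM 2 L Φ₂[L]).symm (fun w => (z w).1 * (endoBlockAt L S w (c w) * (z w).2) * (z w).1⁻¹), (endoTorus L S c).2)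
            ∂(Measure.pi Λw)))
      = ((ρ (chartBoxImg L S)).toReal : ℂ) * (((∏ w, (if w ∈ S then ((|Real.exp (c w 0) - Real.exp (-c w 0)| : ℝ) : ℂ) else 1 - (Circle.exp (c w 2 - c w 0) : ℂ))) *
          ∏ w, ((dsc w : ℝ) : ℂ)) *
          ∫ z, fH ((archPiEquivCM 2 L Φ₂[L]).symm (fun w => (z w).1 * (endoBlockAt L S w (c w) * (z w).2) * (z w).1⁻¹), (endoTorus L S c).2)
            ∂(Measure.pi Λw)) := by ring
    _ = _ := by rw [hprod]; ring

end Assembly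

section AnyHaar

variable (L : Type) [Field L] [NumberField L] [IsCMField L] (S : Finset {w : InfinitePlace L // IsComplex w})
  [∀ w : {w : InfinitePlace L // IsComplex w}, MeasurableSpace ↥(archLocal L 2 Φ₂[L] w)]
  [∀ w : {w : InfinitePlace L // IsComplex w}, BorelSpace ↥(archLocal L 2 Φ₂[L] w)]
  [MeasurableSpace 𝔸[L]] [BorelSpace 𝔸[L]] [MeasurableSpace 𝔹[L]] [BorelSpace 𝔹[L]]
  (νH : Measure (𝔸[L] × 𝔹[L])) [νH.IsHaarMeasure] [νH.IsMulRightInvariant]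

/-- **PER-PLACE FORM FOR AN ARBITRARY HAAR MEASURE `νH`**: the places' Haar measures `ν_w` (right invariant) are EXPORTED together with the leaves (★ `chartOrbH_eq_haarScalarFactor_mul`
absorbs the Haar scalar into `K₀`). [cite: Folland1995, §2.2; §2.6 (2.52)] [cite: Varadarajan1989, §6.4 Lemma 21, Thm 23] -/
theorem exists_placeLeaves_archRH_mul_chartOrbH_eq_of_isHaarMeasure (fH : 𝔸[L] × 𝔹[L] → ℂ) (hfH : Continuous fH) :
    ∃ (νw : ∀ w : {w : InfinitePlace L // IsComplex w}, Measure ↥(archLocal L 2 Φ₂[L] w)) (_ : ∀ w, (νw w).IsHaarMeasure) (_ : ∀ w, (νw w).IsMulRightInvariant)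
      (K₀ : ℝ) (Λw : ∀ w : {w : InfinitePlace L // IsComplex w}, Measure (↥(archLocal L 2 Φ₂[L] w) × ↥(archLocal L 2 Φ₂[L] w)))
      (Zw : ∀ w : {w : InfinitePlace L // IsComplex w}, Set (↥(archLocal L 2 Φ₂[L] w) × ↥(archLocal L 2 Φ₂[L] w))),
      (∀ w, IsFiniteMeasureOnCompacts (Λw w)) ∧ (∀ w, IsClosed (Zw w)) ∧ (∀ w, Λw w (Zw w)ᶜ = 0) ∧
      (∀ w, w ∉ S → Λw w = Measure.map (fun g : ↥(archLocal L 2 Φ₂[L] w) => (g, (1 : ↥(archLocal L 2 Φ₂[L] w)))) (νw w)) ∧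
      (∀ (w) (U : Set ({w : InfinitePlace L // IsComplex w} → Fin 3 → ℝ)), IsCompact U → (w ∉ S → ∀ c ∈ U, Circle.exp (c w 0) ≠ Circle.exp (c w 2)) →
        ∀ C' : Set ↥(archLocal L 2 Φ₂[L] w), IsCompact C' →
          ∃ 𝒮 : Set (↥(archLocal L 2 Φ₂[L] w) × ↥(archLocal L 2 Φ₂[L] w)), IsCompact 𝒮 ∧
            ∀ z ∈ Zw w, ∀ c ∈ U, z.1 * (endoBlockAt L S w (c w) * z.2) * z.1⁻¹ ∈ C' → z ∈ 𝒮) ∧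
      ∀ c : {w : InfinitePlace L // IsComplex w} → Fin 3 → ℝ, c ∈ RegS S →
        archRH S c * chartOrbH L νH S fH c =
          (K₀ : ℂ) * (∏ w, (if w ∈ S then ((Real.exp (c w 0) : ℝ) : ℂ) else 1 - (Circle.exp (c w 2 - c w 0) : ℂ))) *
            ∫ z, fH ((archPiEquivCM 2 L Φ₂[L]).symm (fun w => (z w).1 * (endoBlockAt L S w (c w) * (z w).2) * (z w).1⁻¹), (endoTorus L S c).2)
              ∂(Measure.pi Λw) := by
  haveI : ∀ w : {w : InfinitePlace L // IsComplex w}, LocallyCompactSpace ↥(archLocal L 2 Φ₂[L] w) := fun w => locallyCompactSpace_archLocal_two L w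
  haveI : ∀ w : {w : InfinitePlace L // IsComplex w}, SecondCountableTopology ↥(archLocal L 2 Φ₂[L] w) := fun w => secondCountableTopology_archLocal_two L w
  obtain ⟨νw, hνw⟩ : ∃ νw : ∀ w : {w : InfinitePlace L // IsComplex w}, Measure ↥(archLocal L 2 Φ₂[L] w), ∀ w, (νw w).IsHaarMeasure :=
    ⟨fun w => Measure.haar, fun w => inferInstance⟩
  haveI : ∀ w, (νw w).IsHaarMeasure := hνw
  have hνr : ∀ w : {w : InfinitePlace L // IsComplex w}, (νw w).IsMulRightInvariant := fun w => by
    haveI : LocallyCompactSpace ↥(unitaryGroupOfForm (starRingEnd ℂ) ((Φ₂[L]).map w.1.embedding)) := locallyCompactSpace_archLocal_two L w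
    have h1 : ∀ g : ↥(archLocal L 2 Φ₂[L] w), modularCharacterFun g = 1 := fun g =>
      modularCharacterFun_eq_one_of_eq_over_antidiagonal_two (map_embedding_antidiagTwo_eq_over L w) g
    exact isMulRightInvariant_of_modularCharacterFun_eq_one (G := ↥(archLocal L 2 Φ₂[L] w)) h1 (νw w)
  haveI := hνr
  obtain ⟨νB, hνB⟩ : ∃ νB : Measure 𝔹[L], νB.IsHaarMeasure := ⟨Measure.haar, inferInstance⟩
  haveI := hνB
  haveI : νB.IsMulRightInvariant := (forall_measure_preimage_mul_right_iff νB).1 fun g A _ => by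
    have h : (fun h : 𝔹[L] => h * g) = fun h => g * h := funext fun h => archOne_mul_comm L h g
    rw [h, measure_preimage_mul]
  haveI := isHaarMeasure_prodConventionH L νw νB
  haveI := isMulRightInvariant_prodConventionH L νw νB
  obtain ⟨K₀, Λw, Zw, hΛ, hZ, hnull, hexpl, hprop, hid⟩ := exists_placeLeaves_archRH_mul_chartOrbH_eq L S νw νB
    (((Measure.pi νw).map (archPiEquivCM 2 L Φ₂[L]).symm).prod νB) rfl fH hfH
  refine ⟨νw, hνw, hνr, haarScalarFactor νH (((Measure.pi νw).map (archPiEquivCM 2 L Φ₂[L]).symm).prod νB) * K₀, Λw, Zw, hΛ, hZ, hnull, hexpl, hprop,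
    fun c hc => ?_⟩
  rw [chartOrbH_eq_haarScalarFactor_mul L S νH (((Measure.pi νw).map (archPiEquivCM 2 L Φ₂[L]).symm).prod νB) fH c, ← mul_assoc,
    mul_comm (archRH S c), mul_assoc, hid c hc, Complex.ofReal_mul]
  ring

end AnyHaar

end Literature.NumberTheory.Automorphic.UnitaryGroup

end
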